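import Mathlib
import Literature.Geometry.Lorentzian.KerrConvergence
import Literature.Geometry.Lorentzian.MultiCentreRadiationZone
import Summits.FinalStateConjecture.FinalStateConjecture.Theorems.StarvedNecksKerrSchildTailDecay
import Summits.FinalStateConjecture.FinalStateConjecture.Theorems.StarvedNecksNecksCertifyStubSeamFlatRestrict

/-!
# Route StarvedNecks — crux `GapDecaySuffices` (stmt-FinalStateConjecture-18060), line `Sketch`:
# stub `stub_flatFarCertified` (S2, far certification of the input flat chart)

The registered stub `stub_flatFarCertified : FlatFarCertified` of the line skeleton
`Cruxes/GapDecaySuffices/Lines/Sketch.lean`, with the skeleton's `def`s `flatOnHole` and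
`FlatFarCertified` inlined (a Theorems file cannot import the Cruxes work file).

**Statement.** For a `C⁴` final-state decomposition `d`, a hole `i` with boosted Kerr background
`Bᵢ = d.background i`, profiles `σ → ∞`, `σ'`, flat-time minorant `m → ∞` and a time `τ₂` such that
every coordinate point `y` of the hole slabs `{tᵢ = τ ≥ τ₂, σ(τ) ≤ rᵢ ≤ σ'(τ)}` is late-flat
(`m(τ) ≤ y⁰`, `τ₀ < y⁰`, every excised tube cleared with margin `1`), the sup-`C²` norm over these
slabs of the deviation from `Bᵢ` of the glued chart "`Φ` on the flat domain, `Ψᵢ` elsewhere" tends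
to `0`.

**Proof.** On the slabs the points lie in the OPEN flat domain `U₀`
(`setOf_lt_excision_subset_flatDomain`), where the glued chart is `Φ` read on the common open
refinement `Bᵢ.domain ⊓ U₀`; the differential of an inclusion of opens is the identity, so there
`Ψ^* g − g_{Bᵢ} = (Φ^* g − η) − (g_{Bᵢ} − η)` pointwise (`deviation_eq_of_eqOn_flat`), hence as
germs, hence for all iterated derivatives (locality of `iteratedFDeriv`). The first term at a point
of flat time `y⁰ ≥ m(τ)` is bounded by the flat slab `C⁴` deviation `deviationCk … 4 (y⁰)`, whose
tail supremum over `{s ≥ m(τ)}` tends to `0` (`d.tendsto_deviationCk_flat`, `m → ∞`); the second is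
the boosted Kerr–Schild perturbation, all of whose derivatives are `O(1/rᵢ) ≤ C/σ(τ) → 0`
(`norm_iteratedFDeriv_boostedKsPert_le`, Kerr–Schild 1965, §3). DHRT arXiv:2104.08222, §1 for the
unweighted `Cᵏ` deviation norms. Mathlib + tree lemmas only; no named facts.
-/

noncomputable section

open scoped Manifold ContDiff Topology ENNReal
open Filter Set Topology TopologicalSpace Literature.Geometry.Lorentzian

namespace Summit.FinalStateConjecture.FinalStateConjecture.Theorems.GapDecaySuffices.FarCertified

set_option linter.dupNamespace false

/-! ## Tail suprema -/

/-- Tail suprema `⨆_{s ≥ r} f s` of a function `f : ℝ → ℝ≥0∞` tending to `0` at `+∞` tend to `0`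
(order characterisation of `𝓝 0` in `ℝ≥0∞`). [folklore] -/
theorem tendsto_biSup_ge_atTop_nhds_zero {f : ℝ → ℝ≥0∞} (hf : Tendsto f atTop (𝓝 0)) :
    Tendsto (fun r : ℝ ↦ ⨆ (s : ℝ) (_ : r ≤ s), f s) atTop (𝓝 0) := by
  rw [ENNReal.tendsto_nhds_zero] at hf ⊢
  intro ε hε
  obtain ⟨r₀, hr₀⟩ := eventually_atTop.1 (hf ε hε)
  filter_upwards [eventually_ge_atTop r₀] with r hr
  exact iSup₂_le fun s hs ↦ hr₀ s (hr.trans hs)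

/-! ## The deviation of a chart that is the flat chart on an open overlap -/

variable (𝓢 : Spacetime.{0} 4)

/-- **Deviation of a glued chart on the overlap with a flat chart.** Let `Φ : U → M` be a smooth
chart on an open `U ⊆ E4` and `Ψ : B.domain → M` ANY chart on a reference background `B` which
agrees with `Φ` at the coordinate points of `U`. Then at such a point
`Ψ^* g − g_B = (Φ^* g − η) − (g_B − η)`: both pullbacks are read on the common open refinement
`B.domain ⊓ U`, along whose inclusions (identity differential, Lee 2013, Prop. 3.9) the two charts
coincide; differentiability of `Ψ` there is transported from `Φ` by the local invariance of
differentiability (`liftPropAt_iff_comp_inclusion`). DHRT arXiv:2104.08222, §1 (the deviation).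
[folklore] -/
theorem deviation_eq_of_eqOn_flat (B : ModelBackground) {U : Opens E4} {Φ : U → 𝓢.carrier}
    (hΦ : ContMDiff 𝓘(ℝ, E4) (𝓡 4) ∞ Φ) {Ψ : B.domain → 𝓢.carrier}
    (hΨ : ∀ (x : B.domain) (hx : x.1 ∈ U), Ψ x = Φ ⟨x.1, hx⟩) (x : B.domain) (hx : x.1 ∈ U) :
    𝓢.deviation B Ψ x =
      𝓢.deviation (Minkowski.backgroundOn U) Φ ⟨x.1, hx⟩ - (B.bilin x.1 - Minkowski.bilin) := by
  -- the common open refinement and its two inclusions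
  have h₁ : B.domain ⊓ U ≤ B.domain := inf_le_left
  have h₂ : B.domain ⊓ U ≤ U := inf_le_right
  set w : (B.domain ⊓ U : Opens E4) := ⟨x.1, x.2, hx⟩ with hw
  have hfun : Ψ ∘ Opens.inclusion h₁ = Φ ∘ Opens.inclusion h₂ := funext fun y ↦ hΨ _ y.2.2
  have hΦd : MDifferentiableAt 𝓘(ℝ, E4) (𝓡 4) Φ (Opens.inclusion h₂ w) :=
    (hΦ _).mdifferentiableAt (by simp)
  have hc₂ : MDifferentiableAt 𝓘(ℝ, E4) (𝓡 4) (Φ ∘ Opens.inclusion h₂) w :=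
    hΦd.comp w ((contMDiff_inclusion (n := ∞) h₂ w).mdifferentiableAt (by simp))
  have hc₁ : MDifferentiableAt 𝓘(ℝ, E4) (𝓡 4) (Ψ ∘ Opens.inclusion h₁) w := by
    rw [hfun]
    exact hc₂
  have hΨd : MDifferentiableAt 𝓘(ℝ, E4) (𝓡 4) Ψ (Opens.inclusion h₁ w) :=
    ((differentiableWithinAt_localInvariantProp (I := 𝓘(ℝ, E4)) (I' := 𝓡 4))
      |>.liftPropAt_iff_comp_inclusion h₁ Ψ w).2 hc₁
  have hm₁ := NecksCertifyBargmann.FlatRestrict.mfderiv_comp_inclusion_eq h₁ hΨd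
  have hm₂ := NecksCertifyBargmann.FlatRestrict.mfderiv_comp_inclusion_eq h₂ hΦd
  refine ContinuousLinearMap.ext fun v ↦ ContinuousLinearMap.ext fun v' ↦ ?_
  have hpb :
      pullbackBilin (I := 𝓡 4) (I' := 𝓘(ℝ, E4)) (Ψ ∘ Opens.inclusion h₁) 𝓢.metric.val w v v' =
        pullbackBilin (I := 𝓡 4) (I' := 𝓘(ℝ, E4)) (Φ ∘ Opens.inclusion h₂) 𝓢.metric.val w v v' := by
    rw [hfun]
  have e₁ : 𝓢.metric.val (Ψ x) (mfderiv 𝓘(ℝ, E4) (𝓡 4) Ψ x v) (mfderiv 𝓘(ℝ, E4) (𝓡 4) Ψ x v') =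
      pullbackBilin (I := 𝓡 4) (I' := 𝓘(ℝ, E4)) (Ψ ∘ Opens.inclusion h₁) 𝓢.metric.val w v v' :=
    (congrArg (fun L : E4 →L[ℝ] TangentSpace (𝓡 4) (Ψ x) ↦ 𝓢.metric.val (Ψ x) (L v) (L v'))
      hm₁).symm
  have e₂ : pullbackBilin (I := 𝓡 4) (I' := 𝓘(ℝ, E4)) (Φ ∘ Opens.inclusion h₂) 𝓢.metric.val w v v' =
      𝓢.metric.val (Φ ⟨x.1, hx⟩) (mfderiv 𝓘(ℝ, E4) (𝓡 4) Φ ⟨x.1, hx⟩ v)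
        (mfderiv 𝓘(ℝ, E4) (𝓡 4) Φ ⟨x.1, hx⟩ v') :=
    congrArg (fun L : E4 →L[ℝ] TangentSpace (𝓡 4) (Φ ⟨x.1, hx⟩) ↦
      𝓢.metric.val (Φ ⟨x.1, hx⟩) (L v) (L v')) hm₂
  -- both sides are `G − g_B(v,v')`, resp. `(G − η(v,v')) − (g_B(v,v') − η(v,v'))`, up to unfolding
  have key : ∀ G b e : ℝ, G - b = G - e - (b - e) := fun G b e ↦ by ring
  simp only [sub_apply]
  rw [Spacetime.deviation_apply, Spacetime.deviation_apply, e₁, hpb, e₂]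
  exact key _ _ _

/-- Extended-by-zero, germ form of `deviation_eq_of_eqOn_flat`: near a point of the open overlap
`B.domain ∩ U` the extended deviation of the glued chart `Ψ` from `B` is the extended flat
deviation of `Φ` minus the perturbation `g_B − η` (DHRT arXiv:2104.08222, §1). [folklore] -/
theorem deviationExtend_eventuallyEq_of_eqOn_flat (B : ModelBackground) {U : Opens E4}
    {Φ : U → 𝓢.carrier} (hΦ : ContMDiff 𝓘(ℝ, E4) (𝓡 4) ∞ Φ) {Ψ : B.domain → 𝓢.carrier}
    (hΨ : ∀ (x : B.domain) (hx : x.1 ∈ U), Ψ x = Φ ⟨x.1, hx⟩) {z : E4} (hzB : z ∈ B.domain)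
    (hzU : z ∈ U) :
    𝓢.deviationExtend B Ψ =ᶠ[𝓝 z]
      𝓢.deviationExtend (Minkowski.backgroundOn U) Φ - fun y ↦ B.bilin y - Minkowski.bilin := by
  filter_upwards [(B.domain.2.inter U.2).mem_nhds ⟨hzB, hzU⟩] with y hy
  have e1 := 𝓢.deviationExtend_coe B Ψ ⟨y, hy.1⟩
  have e2 := 𝓢.deviationExtend_coe (Minkowski.backgroundOn U) Φ ⟨y, hy.2⟩
  rw [Pi.sub_apply]
  exact e1.trans ((deviation_eq_of_eqOn_flat 𝓢 B hΦ hΨ ⟨y, hy.1⟩ hy.2).trans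
    (congrArg (· - (B.bilin y - Minkowski.bilin)) e2.symm))

/-! ## The stub -/

open scoped Classical in
/-- **S2 — far certification of the input flat chart against boosted Kerr** (registered stub
`stub_flatFarCertified` of line `Sketch`, crux `GapDecaySuffices`; the skeleton's statement
`FlatFarCertified`, with `flatOnHole` inlined, is bound verbatim as a `let` — `let`/δ-unfolding being
definitional, the lead closes the skeleton stub by `exact stub_flatFarCertified`). On hole slabs
`{tᵢ = τ, σ(τ) ≤ rᵢ ≤ σ'(τ)}` whose coordinate points are late-flat (`τ₀ < y⁰`, off every excised
tube with margin `1`) with flat times `≥ m(τ) → ∞` and `σ → ∞`, the sup-`C²` deviation from the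
boosted Kerr background `Bᵢ` of the glued chart (`Φ` on the flat domain, `Ψᵢ` elsewhere) tends to
`0`: on the open flat domain the glued chart is `Φ`, so `Ψ^* g − g_{Bᵢ} = (Φ^* g − η) − (g_{Bᵢ} − η)`
as germs (`deviationExtend_eventuallyEq_of_eqOn_flat`); the first term is controlled by the tail
supremum of the flat `C⁴` certificate (`tendsto_deviationCk_flat`), the second by the `O(1/rᵢ)`
decay of all derivatives of the boosted Kerr–Schild perturbation
(`norm_iteratedFDeriv_boostedKsPert_le`; Kerr–Schild 1965, §3; DHRT arXiv:2104.08222, §1).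
[folklore] -/
theorem stub_flatFarCertified :
    let FlatFarCertified : Prop :=
      ∀ (𝓢 : Spacetime.{0} 4) (O : Set 𝓢.carrier) (d : FinalStateDecomposition 𝓢 O 4) (i : Fin d.N)
        (σ σ' m : ℝ → ℝ) (τ₂ : ℝ),
        Kerr.IsSubextremal (d.mass i) (d.spin i) →
        Tendsto σ atTop atTop → Tendsto m atTop atTop →
        (∀ x : (d.background i).domain, τ₂ ≤ (d.background i).time x.1 →
          σ ((d.background i).time x.1) ≤ (d.background i).radius x.1 →
          (d.background i).radius x.1 ≤ σ' ((d.background i).time x.1) →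
            m ((d.background i).time x.1) ≤ x.1 0 ∧ d.τ₀ < x.1 0 ∧
              ∀ j, d.excision j (x.1 0) + 1 ≤ (d.background j).radius x.1) →
        Tendsto (fun τ ↦ supCkENorm
          (Subtype.val '' {x : (d.background i).domain | (d.background i).time x.1 = τ ∧
            σ τ ≤ (d.background i).radius x.1 ∧ (d.background i).radius x.1 ≤ σ' τ}) 2
          (𝓢.deviationExtend (d.background i)
            (fun x ↦ if h : x.1 ∈ d.flatDomain then d.flatChart ⟨x.1, h⟩ else d.chart i x)))
          atTop (𝓝 0)
    FlatFarCertified := by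
  intro FlatFarCertified 𝓢 O d i σ σ' m τ₂ _ hσ hm hreg
  -- notation: the background of hole `i`, the glued chart, the two summands
  set B : ModelBackground := d.background i with hB
  set Ψ : B.domain → 𝓢.carrier :=
    fun x ↦ if h : x.1 ∈ d.flatDomain then d.flatChart ⟨x.1, h⟩ else d.chart i x with hΨ
  set F₁ : E4 → E4 →L[ℝ] E4 →L[ℝ] ℝ :=
    𝓢.deviationExtend (Minkowski.backgroundOn d.flatDomain) d.flatChart with hF₁
  set K : E4 → E4 →L[ℝ] E4 →L[ℝ] ℝ := fun y ↦
    boostedKerrBilin (d.motion i).1 (d.motion i).2 (d.mass i) (d.spin i) y - Minkowski.bilin with hK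
  have hΦ : ContMDiff 𝓘(ℝ, E4) (𝓡 4) ∞ d.flatChart := d.isLateChart_flat.contMDiff
  have hΨΦ : ∀ (x : B.domain) (hx : x.1 ∈ d.flatDomain), Ψ x = d.flatChart ⟨x.1, hx⟩ :=
    fun x hx ↦ dif_pos hx
  -- decay of all derivatives of the boosted Kerr–Schild perturbation of hole `i`
  choose C R hR hCR using fun n ↦
    norm_iteratedFDeriv_boostedKsPert_le (d.motion i).1 (d.motion i).2 (d.mass i) (d.spin i) n
  set Cmax : ℝ := ∑ n ∈ Finset.range 3, |C n| with hCmax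
  set Rmax : ℝ := ∑ n ∈ Finset.range 3, R n with hRmax
  have hCn : ∀ n ≤ 2, |C n| ≤ Cmax := fun n hn ↦
    Finset.single_le_sum (f := fun n ↦ |C n|) (fun _ _ ↦ abs_nonneg _)
      (Finset.mem_range.mpr (Nat.lt_succ_of_le hn))
  have hRn : ∀ n ≤ 2, R n ≤ Rmax := fun n hn ↦
    Finset.single_le_sum (f := R) (fun n _ ↦ (hR n).le)
      (Finset.mem_range.mpr (Nat.lt_succ_of_le hn))
  have hRmax0 : 0 < Rmax := (hR 0).trans_le (hRn 0 (Nat.zero_le 2))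
  have hCmax0 : 0 ≤ Cmax := Finset.sum_nonneg fun _ _ ↦ abs_nonneg _
  -- the tail supremum of the flat `C⁴` certificate
  set A : ℝ → ℝ≥0∞ := fun r ↦ ⨆ (s : ℝ) (_ : r ≤ s),
    𝓢.deviationCk (Minkowski.backgroundOn d.flatDomain) d.flatChart 4 s with hA
  -- the main estimate on a late slab
  have hbound : ∀ τ, τ₂ ≤ τ → Rmax ≤ σ τ →
      supCkENorm (Subtype.val '' {x : B.domain | B.time x.1 = τ ∧ σ τ ≤ B.radius x.1 ∧
          B.radius x.1 ≤ σ' τ}) 2 (𝓢.deviationExtend B Ψ) ≤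
        A (m τ) + ENNReal.ofReal (Cmax / σ τ) := by
    intro τ hτ₂ hτR
    refine iSup₂_le fun n hn ↦ iSup₂_le fun z hz ↦ ?_
    obtain ⟨x, ⟨hxt, hxσ, hxσ'⟩, rfl⟩ := hz
    have hστ : 0 < σ τ := hRmax0.trans_le hτR
    -- the point is late-flat
    obtain ⟨hmx, hτ₀, hexc⟩ := hreg x (hxt ▸ hτ₂) (hxt ▸ hxσ) (hxt ▸ hxσ')
    rw [hxt] at hmx
    have hxU : (x : E4) ∈ d.flatDomain :=
      d.setOf_lt_excision_subset_flatDomain ⟨hτ₀, fun j ↦ (lt_add_one _).trans_le (hexc j)⟩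
    have hr0 : 0 < Kerr.radius (d.spin i) (poincareInv (d.motion i).1 (d.motion i).2 x) :=
      hστ.trans_le hxσ
    -- smoothness of the two summands at the point
    have h1 : ContDiffAt ℝ n F₁ x :=
      (𝓢.contDiffAt_deviationExtend_model (Minkowski.backgroundOn d.flatDomain) hΦ ⟨x, hxU⟩
        contDiffAt_const).of_le (by exact_mod_cast le_top)
    have h2 : ContDiffAt ℝ n K x := contDiffAt_boostedKsPert hr0
    -- locality: the glued deviation is `F₁ - K` near the point
    have hev : 𝓢.deviationExtend B Ψ =ᶠ[𝓝 (x : E4)] F₁ - K :=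
      deviationExtend_eventuallyEq_of_eqOn_flat 𝓢 B hΦ hΨΦ x.2 hxU
    rw [(hev.iteratedFDeriv ℝ n).eq_of_nhds, iteratedFDeriv_sub_apply h1 h2]
    refine enorm_sub_le.trans (add_le_add ?_ ?_)
    · -- the flat certificate on the flat slab through the point, flat time `≥ m τ`
      have hmem : (x : E4) ∈
          Subtype.val '' (Minkowski.backgroundOn d.flatDomain).timeSlab ((x : E4) 0) :=
        ⟨⟨x, hxU⟩, rfl, rfl⟩
      exact (enorm_iteratedFDeriv_le_supCkENorm (hn.trans (by norm_num)) hmem F₁).trans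
        (le_iSup₂_of_le (f := fun (s : ℝ) (_ : m τ ≤ s) ↦
          𝓢.deviationCk (Minkowski.backgroundOn d.flatDomain) d.flatChart 4 s) ((x : E4) 0) hmx
          le_rfl)
    · -- the boosted Kerr–Schild tail
      refine enorm_le_ofReal_of_norm_le ?_
      have hRle : R n ≤ Kerr.radius (d.spin i) (poincareInv (d.motion i).1 (d.motion i).2 x) :=
        ((hRn n hn).trans hτR).trans hxσ
      calc (‖iteratedFDeriv ℝ n K x‖ : ℝ)
          ≤ C n / Kerr.radius (d.spin i) (poincareInv (d.motion i).1 (d.motion i).2 x) :=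
            hCR n x hRle
        _ ≤ Cmax / Kerr.radius (d.spin i) (poincareInv (d.motion i).1 (d.motion i).2 x) :=
            div_le_div_of_nonneg_right ((le_abs_self _).trans (hCn n hn)) hr0.le
        _ ≤ Cmax / σ τ := div_le_div_of_nonneg_left hCmax0 hστ hxσ
  -- the majorant tends to `0`
  have hlim : Tendsto (fun τ ↦ A (m τ) + ENNReal.ofReal (Cmax / σ τ)) atTop (𝓝 0) := by
    have hA0 : Tendsto (fun τ ↦ A (m τ)) atTop (𝓝 0) :=
      (tendsto_biSup_ge_atTop_nhds_zero d.tendsto_deviationCk_flat).comp hm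
    have h2 : Tendsto (fun τ ↦ Cmax / σ τ) atTop (𝓝 0) := tendsto_const_nhds.div_atTop hσ
    simpa using hA0.add (ENNReal.tendsto_ofReal h2)
  refine tendsto_of_tendsto_of_tendsto_of_le_of_le' tendsto_const_nhds hlim
    (Eventually.of_forall fun _ ↦ zero_le) ?_
  filter_upwards [eventually_ge_atTop τ₂, hσ.eventually_ge_atTop Rmax] with τ hτ₂ hτR
  exact hbound τ hτ₂ hτR

end Summit.FinalStateConjecture.FinalStateConjecture.Theorems.GapDecaySuffices.FarCertified

end
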